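import Literature.MathematicalPhysics.QuantumFieldTheory.Balaban1983to89.B7Prop8General

/-!
# `Balaban1983to89.B7Prop8PrintedConstants` — T. Bałaban, *Averaging operations for lattice gauge theories*, Commun. Math.
Phys. **98** (1985) 17–51 [Balaban1985Averaging], Sect. F, (175) and Proposition 8 p. 45 WITH THE PRINTED CONSTANTS
`2α₃ + 2C₃α₃²` — for `G`-valued (unitary) gauge transformations at a general unitary background

statement-level skeleton of published theorems with citation tags; proofs where landed; nothing here is a claim about the Yang–Mills mass gap

PDF held: `paper:balaban1985-cmp98-averaging` (journal page = PDF page + 16); render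
`run/shared/lean/pub/pub-balaban/b2b-balaban-ref1/pages/1985-cmp98-averaging/1985-cmp98-averaging-p029-x2.png` (p. 45, READ AS AN
IMAGE by this seat, 2026-08-21).

CITATION HEADER (lean-in-tree rule) / WHAT IS REPRODUCED.  lit-balaban SKELETON rows `B7.Prop8` (Proposition 8 p. 45) and
`B7.Eq171` ((171)–(175) p. 45).  PRINT (p. 45, verbatim from the render): "From this [(173)] it follows that
|(R̄₀uʲ)(x_j) − 1| < 2α₃ + 2C₃(α₃Lʲη)² ≦ 2α₃ + 2C₃α₃², j = 0, 1, …, k,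
|(R̄₀uʲ)⁻¹(x_{j+1})(R̄ʲ_{0,x_{j+1}}R̄₀uʲ)(x_j) − 1| < 2α₃L^{j+1}η + 4C₃(α₃Lʲη)² < (2α₃ + 2C₃α₃²)L^{j+1}η, j = 0, 1, …, k − 1. (175)
We can formulate these results in **Proposition 8.** If u₁, u₂ ∈ Λ_k(U₀, α₃) and α₃ is sufficiently small, i.e., α₃ ≦ c₆ for
some c₆, then u = u₁u₂ ∈ Λ_k(U₀, 2α₃ + 2C₃α₃²) and we have (173)."

WHY THIS FILE.  The tree's kernel forms of (175) / Proposition 8 — `B7Prop8Flat.prop8_flat` (`U₀ = 1`) and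
`B7Prop8General.prop8_general` (general unitary background; unit lit-balaban-r04, p240860) — carry `6α₃ + 8928α₃²` in place of
print's `2α₃ + 2C₃α₃²` (`C₃ = 1116` there): their "Banach reading (a)" does not use that the VALUES `u(x)` are unitary, so
`|ab − 1| ≤ |a − 1| + |b − 1|`, `|e^{ir} − 1| ≤ |r|`, `|R(v)X| = |X|` each cost a factor.  Print's gauge group is `G ⊂ U(N)`
(pp. 18, 23), where the three facts hold exactly; this file supplies them as kernel facts and obtains (175), BOTH LINES, and
Proposition 8 WITH THE PRINTED CONSTANTS — linear coefficient `2`, quadratic coefficient `2C₃` with the tree's explicit `C₃ = 1116`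
of (170)/(173) (print: "the constant in the above bound") — for unitary-valued `u₁, u₂` at a background `U₀` whose averaged
backgrounds `Ū₀ʲ`, `j < k`, are unitary-valued (automatic for unitary `U₀` with (52): `prop8_printed_of52`).  A COMPLEMENT of
`B7Prop8General`: (171)–(173) = `B7Prop8General.eq173_general` BY NAME (nothing of p240860 re-proved); its Banach-reading
`prop8_general'` is USED as the bootstrap putting the averages of `u₁u₂` inside the logarithm's domain, hence unitary.

CONTENTS (kernel, no `sorry`; `≤` for print's `<`; `η` free with `L^kη ≤ 1` — print `η = L^{−k}`): §0 C⋆-bookkeeping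
(`‖e^{X} − 1‖ ≤ ‖X‖` for `X⋆ = −X` from the tree's (24) `MatrixLog.norm_expUnitary_sub_one_le`, and for `e^{X}` unitary with
`‖X‖ ≤ 1/5` via (22)–(23) `B7Prop2Explicit.star_mlog_eq_neg`); §1 `uavg_mem_unitaryUnits` — the averages (79)–(80)
`\overline{R₀u}ʲ` of a unitary-valued `u` at unitary levels are unitary-valued under the (167)-smallness (print's tacit
"`G`-valued in, `G`-valued out", p. 44); §2 the phase `e^{r_j}` of (173) is unitary, `‖e^{±r_j} − 1‖ ≤ ‖r_j‖`; §3 `ineq175_line1` /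
`cond166_mul_printed`; §4 `ineq175_line2` / `cond167_mul_printed` (last step `2Lʲη ≤ 1`, `j < k`); §5 **`prop8_printed`**
(`u₁u₂ ∈ Λ_k(U₀, 2α₃ + 2·1116·α₃²)`), `prop8_printed_with173`, `prop8_printed_of52`.  READINGS as `B7Prop8General`: explicit
`0 ≤ α₃ ≤ 1/3000` (an admissible `c₆`), `L ≥ 2`, `0 ≤ η`, `L^kη ≤ 1`, `ℤ^d` carriers; the abstract-carrier `B7.Prop8Printed` is not
instantiated (different interface).  NOT CLAIMED: optimality of `C₃`; print's unstated `c₆`.  Unit `lit-balaban-p05` gen 3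
(literature-prover-lit-balaban-p05-g3-0), Phase-2 row B7.Prop8 (owner r04, referee ref-4); HOME `run/shared/lean/pub/lit-balaban/`.
-/

noncomputable section

open NormedSpace Finset

namespace Literature.MathematicalPhysics.QuantumFieldTheory.Balaban1983to89.B7Prop8PrintedConstants

open B7Prop1Explicit MatrixLog B7Prop2Explicit B7Eq92Concrete B7Eq99Concrete B7Eq84Concrete B7Eq167Flat B7Eq170Flat
  B7Eq170General B7Prop8Flat B7Prop8General

export B7Prop1Explicit (Site)

variable {d : ℕ}

variable {𝔸 : Type*} [CStarAlgebra 𝔸]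

/-! ## §0 Unitary bookkeeping in a C⋆-algebra (print's `G ⊂ U(N)`, pp. 18, 23) -/

/-- `|abc − 1| ≤ |a − 1| + |b − 1| + |c − 1|` when `a`, `b` are unitary: `abc − 1 = ab(c − 1) + a(b − 1) + (a − 1)` and left
multiplication by a unitary is an isometry (print's tacit bookkeeping for (175), `G ⊂ U(N)`). [folklore] -/
private theorem norm_mul₃_sub_one_le_of_unitary {A B C : 𝔸} (hA : A ∈ unitary 𝔸) (hB : B ∈ unitary 𝔸) :
    ‖A * B * C - 1‖ ≤ ‖A - 1‖ + ‖B - 1‖ + ‖C - 1‖ := by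
  have h : A * B * C - 1 = A * B * (C - 1) + A * (B - 1) + (A - 1) := by noncomm_ring
  have h1 : ‖A * B * (C - 1)‖ = ‖C - 1‖ := CStarRing.norm_mem_unitary_mul _ (mul_mem hA hB)
  have h2 : ‖A * (B - 1)‖ = ‖B - 1‖ := CStarRing.norm_mem_unitary_mul _ hA
  rw [h]
  calc ‖A * B * (C - 1) + A * (B - 1) + (A - 1)‖ ≤ ‖A * B * (C - 1)‖ + ‖A * (B - 1)‖ + ‖A - 1‖ := norm_add₃_le
    _ = ‖A - 1‖ + ‖B - 1‖ + ‖C - 1‖ := by rw [h1, h2]; ring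

/-- `|abcd − 1| ≤ |a − 1| + |b − 1| + |c − 1| + |d − 1|` when `a`, `b`, `c` are unitary (same telescoping, one factor more).
[folklore] -/
private theorem norm_mul₄_sub_one_le_of_unitary {A B C D : 𝔸} (hA : A ∈ unitary 𝔸) (hB : B ∈ unitary 𝔸) (hC : C ∈ unitary 𝔸) :
    ‖A * B * C * D - 1‖ ≤ ‖A - 1‖ + ‖B - 1‖ + ‖C - 1‖ + ‖D - 1‖ := by
  have h : A * B * C * D - 1 = A * B * C * (D - 1) + (A * B * C - 1) := by noncomm_ring
  have h1 : ‖A * B * C * (D - 1)‖ = ‖D - 1‖ := CStarRing.norm_mem_unitary_mul _ (mul_mem (mul_mem hA hB) hC)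
  rw [h]
  calc ‖A * B * C * (D - 1) + (A * B * C - 1)‖ ≤ ‖A * B * C * (D - 1)‖ + ‖A * B * C - 1‖ := norm_add_le _ _
    _ ≤ ‖D - 1‖ + (‖A - 1‖ + ‖B - 1‖ + ‖C - 1‖) := by
        rw [h1]; gcongr; exact norm_mul₃_sub_one_le_of_unitary hA hB
    _ = ‖A - 1‖ + ‖B - 1‖ + ‖C - 1‖ + ‖D - 1‖ := by ring

/-- **(24) p. 21 for a skew-adjoint exponent**: `‖e^{X} − 1‖ ≤ ‖X‖` when `X⋆ = −X` (`X = iA`, `A` hermitian: the tree's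
`MatrixLog.norm_expUnitary_sub_one_le` for the self-adjoint `−iX`). [cite: Balaban1985Averaging, (24) p.21] -/
theorem norm_exp_sub_one_le_of_star_eq_neg {X : 𝔸} (hX : star X = -X) : ‖exp X - 1‖ ≤ ‖X‖ := by
  have hsa : IsSelfAdjoint ((-Complex.I) • X) := by
    rw [IsSelfAdjoint, star_smul, hX, Complex.star_def, map_neg, Complex.conj_I, neg_neg, smul_neg, neg_smul]
  have h := MatrixLog.norm_expUnitary_sub_one_le (⟨(-Complex.I) • X, hsa⟩ : selfAdjoint 𝔸)
  have h1 : ((selfAdjoint.expUnitary (⟨(-Complex.I) • X, hsa⟩ : selfAdjoint 𝔸) : unitary 𝔸) : 𝔸) = exp X := by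
    rw [selfAdjoint.expUnitary_coe]
    simp only [smul_smul, mul_neg, Complex.I_mul_I, neg_neg, one_smul]
  have h2 : ‖(⟨(-Complex.I) • X, hsa⟩ : selfAdjoint 𝔸)‖ = ‖X‖ := by
    rw [AddSubgroup.coe_norm]
    show ‖(-Complex.I) • X‖ = ‖X‖
    rw [norm_smul, norm_neg, Complex.norm_I, one_mul]
  rw [h1, h2] at h
  exact h

/-- **(22)–(24) combined**: if `e^{X}` is unitary and `‖X‖ ≤ 1/5` then `X = log e^{X}` is skew-adjoint ((22)–(23),
`B7Prop2Explicit.star_mlog_eq_neg`, since `‖e^{X} − 1‖ ≤ e^{1/5} − 1 ≤ 1/4`), hence `‖e^{X} − 1‖ ≤ ‖X‖` ((24)).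
[cite: Balaban1985Averaging, (22)–(24) p.21] -/
theorem norm_exp_sub_one_le_of_mem_unitary {X : 𝔸} (hU : exp X ∈ unitary 𝔸) (hs : ‖X‖ ≤ 1 / 5) :
    ‖exp X - 1‖ ≤ ‖X‖ := by
  have h1 : ‖exp X - 1‖ ≤ 1 / 4 := by
    have := B7Transfer.norm_exp_sub_one_le_of_le X hs
    linarith [B7Eq31BCH.exp_one_fifth_le]
  have hstar : star (mlog (exp X)) = -mlog (exp X) := star_mlog_eq_neg hU h1
  rw [mlog_exp_of_le hs] at hstar
  exact norm_exp_sub_one_le_of_star_eq_neg hstar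

/-- The rotation (56) `R(X)Y = XYX⁻¹` keeps a subgroup of units (here `U(N)`) invariant. [cite: Balaban1985Averaging, (56) p.27] -/
theorem Rc_mem_unitaryUnits {X Y : 𝔸ˣ} (hX : X ∈ unitaryUnits 𝔸) (hY : Y ∈ unitaryUnits 𝔸) :
    Rc X Y ∈ unitaryUnits 𝔸 := by
  rw [Rc_apply]
  exact (unitaryUnits 𝔸).mul_mem ((unitaryUnits 𝔸).mul_mem hX hY) ((unitaryUnits 𝔸).inv_mem hX)

/-! ## §1 The averages `\overline{R₀u}ʲ` of a unitary-valued gauge transformation are unitary-valued -/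

section Averages

variable {L : ℕ} {U₀ : Site d → Fin d → 𝔸ˣ} {u : Site d → 𝔸ˣ} {k : ℕ} {β η : ℝ}

/-- **`\overline{R₀u}ʲ` is `G`-valued** (tacit in print, p. 44: "for `u ∈ Λ_k(U₀, α₃)` and `α₃` small, all operations needed to
define `R̄₀uᵏ` are done always in a case where proper expressions are small. More exactly, we have to calculate a logarithm of
the expression in (167) and this expression is small"): for a unitary-valued `u` satisfying (167) with `βL^kη ≤ 1/4` at a
background whose averaged backgrounds `Ū₀ʲ`, `j < k`, are unitary-valued, every `\overline{R₀u}ʲ(x_j)`, `j ≤ k`, is unitary —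
by (78)/(80) (`B7Eq99Concrete.val_R0avg`, `B7Eq84Concrete.uavg_succ`) it is `ūʲ(Lx)·exp[Σ_x L^{−d} log(…)]` with the logarithms
of the unitary (167)-quantities skew-adjoint ((22)–(23), `B7Prop2Explicit.star_mlog_eq_neg`).
[cite: Balaban1985Averaging, (166)–(167) p.44, (78)–(80) p.30, (22)–(23) p.21] -/
theorem uavg_mem_unitaryUnits (hV : ∀ j < k, ∀ (x : Site d) (κ : Fin d), avgIter L U₀ j x κ ∈ unitaryUnits 𝔸)
    (hu : ∀ x, u x ∈ unitaryUnits 𝔸) (h167 : Cond167 L U₀ u k β η)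
    (hL : 1 ≤ L) (hη : 0 ≤ η) (hβ : 0 ≤ β) (hs : β * (L : ℝ) ^ k * η ≤ 1 / 4) :
    ∀ j ≤ k, ∀ z : Site d, uavg L U₀ u j z ∈ unitaryUnits 𝔸 := by
  have hLr : (1 : ℝ) ≤ L := by exact_mod_cast hL
  intro j
  induction j with
  | zero =>
    intro _ z
    rw [uavg_zero]
    exact hu z
  | succ j ih =>
    intro hjk z
    have hjlt : j < k := Nat.lt_of_succ_le hjk
    have ihj := ih hjlt.le
    set y : Site d := (L : ℤ) • z with hy
    rw [mem_unitaryUnits, uavg_succ, val_R0avg]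
    refine Submonoid.mul_mem _ ((mem_unitaryUnits).1 (ihj y)) ?_
    have hS : (∑ r : Fin d → Fin L, (((L : ℝ) ^ d)⁻¹) •
        mlog ((((uavg L U₀ u j y)⁻¹ *
          Rc (hol (avgIter L U₀ j) y (treeWord (boxVec L r))) (uavg L U₀ u j (y + boxVec L r)) : 𝔸ˣ)) : 𝔸)) ∈
        skewAdjoint 𝔸 := by
      refine sum_mem fun r _ => skewAdjoint.smul_mem _ ?_
      rw [skewAdjoint.mem_iff]
      refine star_mlog_eq_neg ?_ ?_
      · exact (mem_unitaryUnits).1 ((unitaryUnits 𝔸).mul_mem ((unitaryUnits 𝔸).inv_mem (ihj y))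
          (Rc_mem_unitaryUnits (hol_mem_of (hV j hjlt) _ _) (ihj _)))
      · calc ‖((((uavg L U₀ u j y)⁻¹ *
              Rc (hol (avgIter L U₀ j) y (treeWord (boxVec L r))) (uavg L U₀ u j (y + boxVec L r)) : 𝔸ˣ)) : 𝔸) - 1‖
            ≤ β * (L : ℝ) ^ (j + 1) * η := h167 j hjlt z r
          _ ≤ β * (L : ℝ) ^ k * η :=
            mul_le_mul_of_nonneg_right (mul_le_mul_of_nonneg_left (pow_le_pow_right₀ hLr hjk) hβ) hη
          _ ≤ 1 / 4 := hs
    letI : NormedAlgebra ℚ 𝔸 := NormedAlgebra.restrictScalars ℚ ℂ 𝔸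
    exact NormedSpace.exp_mem_unitary_of_mem_skewAdjoint hS

end Averages

/-! ## §2 The phase `e^{r_j}` of (173) is unitary, hence `‖e^{±r_j} − 1‖ ≤ ‖r_j‖` -/

section Phase

variable {L : ℕ} {U₀ : Site d → Fin d → 𝔸ˣ} {u₁ u₂ : Site d → 𝔸ˣ} {j : ℕ} {r : Site d → 𝔸} {z : Site d}

/-- In the factorisation (171)/(173) `(R̄₀uʲ)(x_j) = (R̄₀u₁ʲ)(x_j)(R̄₀u₂ʲ)(x_j)e^{ir_j(x_j)}` with all three averages `G`-valued,
the phase `e^{ir_j(x_j)} = [(R̄₀u₁ʲ)(x_j)(R̄₀u₂ʲ)(x_j)]⁻¹(R̄₀uʲ)(x_j)` is `G`-valued (unitary). [cite: Balaban1985Averaging, (171)–(173) p.45] -/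
theorem expUnit_phase_mem_unitaryUnits
    (hE : uavg L U₀ (u₁ * u₂) j = vprod (uavg L U₀ u₁ j) (uavg L U₀ u₂ j) r)
    (h₁ : uavg L U₀ u₁ j z ∈ unitaryUnits 𝔸) (h₂ : uavg L U₀ u₂ j z ∈ unitaryUnits 𝔸)
    (h₁₂ : uavg L U₀ (u₁ * u₂) j z ∈ unitaryUnits 𝔸) : expUnit (r z) ∈ unitaryUnits 𝔸 := by
  have h := congr_fun hE z
  rw [vprod_apply] at h
  have hr : expUnit (r z) = (uavg L U₀ u₁ j z * uavg L U₀ u₂ j z)⁻¹ * uavg L U₀ (u₁ * u₂) j z := by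
    rw [h]; group
  rw [hr]
  exact (unitaryUnits 𝔸).mul_mem ((unitaryUnits 𝔸).inv_mem ((unitaryUnits 𝔸).mul_mem h₁ h₂)) h₁₂

/-- Hence **`|e^{ir_j} − 1| ≤ |r_j|`** and `|e^{−ir_j} − 1| ≤ |r_j|` (print's (24) bookkeeping in (175)), provided `‖r_j‖ ≤ 1/5`
(so that `ir_j = log e^{ir_j}` is skew-adjoint). [cite: Balaban1985Averaging, (175) p.45, (24) p.21] -/
theorem norm_exp_phase_sub_one_le (hr : expUnit (r z) ∈ unitaryUnits 𝔸) (hs : ‖r z‖ ≤ 1 / 5) :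
    ‖exp (r z) - 1‖ ≤ ‖r z‖ ∧ ‖exp (-r z) - 1‖ ≤ ‖r z‖ := by
  refine ⟨norm_exp_sub_one_le_of_mem_unitary ((mem_unitaryUnits).1 hr) hs, ?_⟩
  have h' : exp (-r z) ∈ unitary 𝔸 := by
    have := (mem_unitaryUnits).1 ((unitaryUnits 𝔸).inv_mem hr)
    rwa [val_inv_expUnit, val_expUnit] at this
  exact (norm_exp_sub_one_le_of_mem_unitary h' (by rwa [norm_neg])).trans (norm_neg (r z)).le

end Phase

/-! ## §3–§5 (175) and Proposition 8 with the printed constants, at a general unitary background -/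

section Printed

variable {L : ℕ} {U₀ : Site d → Fin d → 𝔸ˣ} {u₁ u₂ : Site d → 𝔸ˣ} {k : ℕ} {α₃ η : ℝ}

/-- The unitary hypotheses in the two currencies of the tree (`B7Prop2Explicit.unitaryUnits` ↔ Mathlib's `unitary`). [folklore] -/
private theorem levels_mem_unitary (hV : ∀ j < k, ∀ (x : Site d) (κ : Fin d), avgIter L U₀ j x κ ∈ unitaryUnits 𝔸) :
    ∀ j < k, ∀ (x : Site d) (κ : Fin d), ((avgIter L U₀ j x κ : 𝔸ˣ) : 𝔸) ∈ unitary 𝔸 :=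
  fun j hj x κ => (mem_unitaryUnits).1 (hV j hj x κ)

/-- The product of two `G`-valued gauge transformations is `G`-valued. [folklore] -/
private theorem mul_mem_unitaryUnits (hu₁ : ∀ x, u₁ x ∈ unitaryUnits 𝔸) (hu₂ : ∀ x, u₂ x ∈ unitaryUnits 𝔸) :
    ∀ x, (u₁ * u₂) x ∈ unitaryUnits 𝔸 := fun x => by
  rw [Pi.mul_apply]; exact (unitaryUnits 𝔸).mul_mem (hu₁ x) (hu₂ x)

variable (hV : ∀ j < k, ∀ (x : Site d) (κ : Fin d), avgIter L U₀ j x κ ∈ unitaryUnits 𝔸)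
  (hu₁ : ∀ x, u₁ x ∈ unitaryUnits 𝔸) (hu₂ : ∀ x, u₂ x ∈ unitaryUnits 𝔸)
  (hL : 2 ≤ L) (hη : 0 ≤ η) (hk : (L : ℝ) ^ k * η ≤ 1) (hα0 : 0 ≤ α₃) (hα : α₃ ≤ 1 / 3000)
  (h₁ : InLambda L U₀ u₁ k α₃ η) (h₂ : InLambda L U₀ u₂ k α₃ η)
include hV hu₁ hu₂ hL hη hk hα0 hα h₁ h₂

/-- BOOTSTRAP: all three families of averages `ū₁ʲ`, `ū₂ʲ`, `ūʲ` (`u = u₁u₂`), `j ≤ k`, are unitary-valued under the hypotheses of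
Proposition 8 — for `u₁`, `u₂` by (167) with `α₃`, for `u₁u₂` by (167) with the Banach-reading constant `10α₃` of
`B7Prop8General.prop8_general'` (`10α₃L^kη ≤ 1/300 ≤ 1/4`). [cite: Balaban1985Averaging, Proposition 8 p.45, (166)–(167) p.44] -/
theorem averages_mem_unitaryUnits :
    ∀ j ≤ k, ∀ z : Site d, uavg L U₀ u₁ j z ∈ unitaryUnits 𝔸 ∧ uavg L U₀ u₂ j z ∈ unitaryUnits 𝔸 ∧
      uavg L U₀ (u₁ * u₂) j z ∈ unitaryUnits 𝔸 := by
  have hL1 : 1 ≤ L := le_trans (by norm_num) hL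
  have ht : α₃ * (L : ℝ) ^ k * η ≤ 1 / 3000 := by
    rw [mul_assoc]; exact (mul_le_of_le_one_right hα0 hk).trans hα
  have h12 : InLambda L U₀ (u₁ * u₂) k (10 * α₃) η :=
    prop8_general' (levels_mem_unitary hV) hL hη hk hα0 hα h₁ h₂
  have ht12 : 10 * α₃ * (L : ℝ) ^ k * η ≤ 1 / 4 := by
    have : 10 * α₃ * (L : ℝ) ^ k * η = 10 * (α₃ * (L : ℝ) ^ k * η) := by ring
    rw [this]; linarith
  intro j hj z
  exact ⟨uavg_mem_unitaryUnits hV hu₁ h₁.2 hL1 hη hα0 (ht.trans (by norm_num)) j hj z,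
    uavg_mem_unitaryUnits hV hu₂ h₂.2 hL1 hη hα0 (ht.trans (by norm_num)) j hj z,
    uavg_mem_unitaryUnits hV (mul_mem_unitaryUnits hu₁ hu₂) h12.2 hL1 hη (by positivity) ht12 j hj z⟩

/-- **(175), FIRST LINE, with the printed constants** ("`|(R̄₀uʲ)(x_j) − 1| < 2α₃ + 2C₃(α₃Lʲη)²`, `j = 0, 1, …, k`"): for
unitary-valued `u₁, u₂ ∈ Λ_k(U₀, α₃)` at a background with unitary-valued `Ū₀ʲ` (`j < k`), `L ≥ 2`, `0 ≤ η`, `L^kη ≤ 1`,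
`0 ≤ α₃ ≤ 1/3000`: `‖\overline{R₀(u₁u₂)}ʲ(x_j) − 1‖ ≤ 2α₃ + 2·C₃·(α₃Lʲη)²` with `C₃ = 1116` — from (173)
(`B7Prop8General.eq173_general`: `ūʲ = ū₁ʲū₂ʲe^{r_j}`, `‖r_j‖ ≤ 2C₃(α₃Lʲη)²`) by `|ab e^{ir} − 1| ≤ |a − 1| + |b − 1| + |e^{ir} − 1|`
(unitary factors) and `|e^{ir} − 1| ≤ |r|`. [cite: Balaban1985Averaging, (175) p.45, (173) p.45, (166) p.44] -/
theorem ineq175_line1 :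
    ∀ j ≤ k, ∀ z : Site d,
      ‖((uavg L U₀ (u₁ * u₂) j z : 𝔸ˣ) : 𝔸) - 1‖ ≤ 2 * α₃ + 2 * 1116 * (α₃ * (L : ℝ) ^ j * η) ^ 2 := by
  have hL1 : 1 ≤ L := le_trans (by norm_num) hL
  have hLr : (1 : ℝ) ≤ L := by exact_mod_cast hL1
  have ht : α₃ * (L : ℝ) ^ k * η ≤ 1 / 3000 := by
    rw [mul_assoc]; exact (mul_le_of_le_one_right hα0 hk).trans hα
  have hun := averages_mem_unitaryUnits hV hu₁ hu₂ hL hη hk hα0 hα h₁ h₂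
  intro j hj z
  obtain ⟨r, hE, hB⟩ := eq173_general (levels_mem_unitary hV) hL hη hα0 (hα.trans (by norm_num)) ht h₁ h₂ j hj
  obtain ⟨hz₁, hz₂, hz₁₂⟩ := hun j hj z
  set b : ℝ := α₃ * (L : ℝ) ^ j * η with hb
  have hb0 : 0 ≤ b := by rw [hb]; positivity
  have hbk : b ≤ 1 / 3000 :=
    (mul_le_mul_of_nonneg_right (mul_le_mul_of_nonneg_left (pow_le_pow_right₀ hLr hj) hα0) hη).trans ht
  have hrs : ‖r z‖ ≤ 1 / 5 := (hB z).trans (by nlinarith)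
  have hphase := (norm_exp_phase_sub_one_le (expUnit_phase_mem_unitaryUnits hE hz₁ hz₂ hz₁₂) hrs).1
  rw [hE, vprod_apply, Units.val_mul, Units.val_mul, val_expUnit]
  calc ‖((uavg L U₀ u₁ j z : 𝔸ˣ) : 𝔸) * ((uavg L U₀ u₂ j z : 𝔸ˣ) : 𝔸) * exp (r z) - 1‖
      ≤ ‖((uavg L U₀ u₁ j z : 𝔸ˣ) : 𝔸) - 1‖ + ‖((uavg L U₀ u₂ j z : 𝔸ˣ) : 𝔸) - 1‖ + ‖exp (r z) - 1‖ :=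
        norm_mul₃_sub_one_le_of_unitary ((mem_unitaryUnits).1 hz₁) ((mem_unitaryUnits).1 hz₂)
    _ ≤ α₃ + α₃ + 2 * 1116 * b ^ 2 := by
        gcongr
        · exact h₁.1 j hj z
        · exact h₂.1 j hj z
        · exact hphase.trans (hB z)
    _ = 2 * α₃ + 2 * 1116 * b ^ 2 := by ring

/-- **(175), first line ⇒ (166) for `u₁u₂` with the printed constant** ("`≦ 2α₃ + 2C₃α₃²`", since `Lʲη ≤ 1`):
`u₁u₂` satisfies (166) with `2α₃ + 2C₃α₃²`, `C₃ = 1116`. [cite: Balaban1985Averaging, (175) p.45, (166) p.44] -/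
theorem cond166_mul_printed :
    Cond166 L U₀ (u₁ * u₂) k (2 * α₃ + 2 * 1116 * α₃ ^ 2) := by
  have hL1 : 1 ≤ L := le_trans (by norm_num) hL
  intro j hj z
  refine (ineq175_line1 hV hu₁ hu₂ hL hη hk hα0 hα h₁ h₂ j hj z).trans ?_
  obtain ⟨hj1, -⟩ := pow_eta_le hL1 hη hk hj
  have hb1 : α₃ * (L : ℝ) ^ j * η ≤ α₃ := by
    rw [mul_assoc]; exact mul_le_of_le_one_right hα0 hj1
  have hb0 : 0 ≤ α₃ * (L : ℝ) ^ j * η := by positivity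
  nlinarith [pow_le_pow_left₀ hb0 hb1 2]

/-- **(175), SECOND LINE, with the printed constants** ("`|(R̄₀uʲ)⁻¹(x_{j+1})(R̄ʲ_{0,x_{j+1}}R̄₀uʲ)(x_j) − 1| <
2α₃L^{j+1}η + 4C₃(α₃Lʲη)²`, `j = 0, 1, …, k − 1`"), `C₃ = 1116`: the (167)-quantity of `u = u₁u₂` at level `j < k`, with
`y = Lx_{j+1}`, `x_j = y + r′ ∈ B(y)` and the rotation `R̄ʲ_{0,y} = R(Ū₀ʲ(Γ_{y,x_j}))` (`B7Eq99Concrete.R0fun`), is by (168)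
(`B7Eq170General.R0fun_vprod`, `B7Eq170Flat.eq168_factor`)
`e^{−ir_j(y)}·R(ū₂ʲ(y)⁻¹)[ū₁ʲ(y)⁻¹(R̄ʲ_{0,y}ū₁ʲ)(x_j)]·ū₂ʲ(y)⁻¹(R̄ʲ_{0,y}ū₂ʲ)(x_j)·e^{i(R̄ʲ_{0,y}r_j)(x_j)}`; all four factors are
unitary, so the deviations from `1` ADD: `≤ ‖r_j(y)‖ + α₃L^{j+1}η + α₃L^{j+1}η + ‖r_j(x_j)‖` (`|R(v)X| = |X|`, `|e^{ir} − 1| ≤ |r|`),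
`‖r_j‖ ≤ 2C₃(α₃Lʲη)²`. [cite: Balaban1985Averaging, (175) p.45, (167)–(168) p.44] -/
theorem ineq175_line2 :
    ∀ j < k, ∀ (z : Site d) (r' : Fin d → Fin L),
      ‖((((uavg L U₀ (u₁ * u₂) j ((L : ℤ) • z))⁻¹ *
          R0fun (avgIter L U₀ j) ((L : ℤ) • z) (uavg L U₀ (u₁ * u₂) j) ((L : ℤ) • z + boxVec L r') : 𝔸ˣ)) : 𝔸) - 1‖
        ≤ 2 * (α₃ * (L : ℝ) ^ (j + 1) * η) + 4 * 1116 * (α₃ * (L : ℝ) ^ j * η) ^ 2 := by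
  have hL1 : 1 ≤ L := le_trans (by norm_num) hL
  have hLr : (1 : ℝ) ≤ L := by exact_mod_cast hL1
  have ht : α₃ * (L : ℝ) ^ k * η ≤ 1 / 3000 := by
    rw [mul_assoc]; exact (mul_le_of_le_one_right hα0 hk).trans hα
  have hVu := levels_mem_unitary hV
  have h167₁ := (cond167_iff_R0fun L U₀ u₁ k α₃ η).1 h₁.2
  have h167₂ := (cond167_iff_R0fun L U₀ u₂ k α₃ η).1 h₂.2
  have hun := averages_mem_unitaryUnits hV hu₁ hu₂ hL hη hk hα0 hα h₁ h₂
  intro j hj z r'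
  obtain ⟨r, hE, hB⟩ := eq173_general hVu hL hη hα0 (hα.trans (by norm_num)) ht h₁ h₂ j hj.le
  -- abbreviations
  set V : Site d → Fin d → 𝔸ˣ := avgIter L U₀ j with hVdef
  have hVj : ∀ (x : Site d) (κ : Fin d), V x κ ∈ unitaryUnits 𝔸 := fun x κ => hV j hj x κ
  set y : Site d := (L : ℤ) • z with hy
  set x : Site d := (L : ℤ) • z + boxVec L r' with hx
  set b : ℝ := α₃ * (L : ℝ) ^ j * η with hb
  set a : ℝ := α₃ * (L : ℝ) ^ (j + 1) * η with ha
  have hb0 : 0 ≤ b := by rw [hb]; positivity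
  have hbk : b ≤ 1 / 3000 :=
    (mul_le_mul_of_nonneg_right (mul_le_mul_of_nonneg_left (pow_le_pow_right₀ hLr hj.le) hα0) hη).trans ht
  have hrs : ∀ w : Site d, ‖r w‖ ≤ 1 / 5 := fun w => (hB w).trans (by nlinarith)
  -- unitarity of the averages at the two sites
  obtain ⟨hy₁, hy₂, hy₁₂⟩ := hun j hj.le y
  obtain ⟨hx₁, hx₂, hx₁₂⟩ := hun j hj.le x
  -- rotate the product and factorise (168)
  set w₁ : Site d → 𝔸ˣ := R0fun V y (uavg L U₀ u₁ j) with hw₁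
  set w₂ : Site d → 𝔸ˣ := R0fun V y (uavg L U₀ u₂ j) with hw₂
  set ρ : Site d → 𝔸 := R0lie V y r with hρ
  have hrot : R0fun V y (uavg L U₀ (u₁ * u₂) j) x = vprod w₁ w₂ ρ x := by
    rw [hE, R0fun_vprod]
  have hctr : uavg L U₀ (u₁ * u₂) j y = vprod w₁ w₂ ρ y := by
    rw [hE, hw₁, hw₂, hρ, vprod_R0fun_self]
  rw [hrot, hctr, eq168_factor, Units.val_mul, Units.val_mul, Units.val_mul, val_expUnit, val_expUnit, val_Rc_eq_cj]
  -- values at the centre and unitarity of the pieces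
  have hw₁y : w₁ y = uavg L U₀ u₁ j y := by rw [hw₁, R0fun_self]
  have hw₂y : w₂ y = uavg L U₀ u₂ j y := by rw [hw₂, R0fun_self]
  have hρy : ρ y = r y := by rw [hρ, R0lie_self]
  have hw₁x : w₁ x ∈ unitaryUnits 𝔸 := by
    rw [hw₁, R0fun_apply]; exact Rc_mem_unitaryUnits (hol_mem_of hVj _ _) hx₁
  have hw₂x : w₂ x ∈ unitaryUnits 𝔸 := by
    rw [hw₂, R0fun_apply]; exact Rc_mem_unitaryUnits (hol_mem_of hVj _ _) hx₂
  have hw₁y' : w₁ y ∈ unitaryUnits 𝔸 := by rw [hw₁y]; exact hy₁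
  have hw₂y' : w₂ y ∈ unitaryUnits 𝔸 := by rw [hw₂y]; exact hy₂
  -- factor A = e^{-r(y)}
  have hA : exp (-ρ y) ∈ unitary 𝔸 := by
    rw [hρy]
    have := (mem_unitaryUnits).1 ((unitaryUnits 𝔸).inv_mem (expUnit_phase_mem_unitaryUnits hE hy₁ hy₂ hy₁₂))
    rwa [val_inv_expUnit, val_expUnit] at this
  have hAn : ‖exp (-ρ y) - 1‖ ≤ 2 * 1116 * b ^ 2 := by
    rw [hρy]
    exact ((norm_exp_phase_sub_one_le (expUnit_phase_mem_unitaryUnits hE hy₁ hy₂ hy₁₂) (hrs y)).2).trans (hB y)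
  -- factor B = R(ū₂(y)⁻¹)[ū₁(y)⁻¹ (R̄ ū₁)(x)]
  have hBu : cj (w₂ y)⁻¹ ((((w₁ y)⁻¹ * w₁ x : 𝔸ˣ)) : 𝔸) ∈ unitary 𝔸 := by
    rw [← val_Rc_eq_cj]
    exact (mem_unitaryUnits).1 (Rc_mem_unitaryUnits ((unitaryUnits 𝔸).inv_mem hw₂y')
      ((unitaryUnits 𝔸).mul_mem ((unitaryUnits 𝔸).inv_mem hw₁y') hw₁x))
  have hBn : ‖cj (w₂ y)⁻¹ ((((w₁ y)⁻¹ * w₁ x : 𝔸ˣ)) : 𝔸) - 1‖ ≤ a := by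
    rw [cj_sub_one, norm_cj_of_mem_unitary ((mem_unitaryUnits).1 ((unitaryUnits 𝔸).inv_mem hw₂y')), hw₁y]
    exact h167₁ j hj z r'
  -- factor C = ū₂(y)⁻¹ (R̄ ū₂)(x)
  have hCu : ((((w₂ y)⁻¹ * w₂ x : 𝔸ˣ)) : 𝔸) ∈ unitary 𝔸 :=
    (mem_unitaryUnits).1 ((unitaryUnits 𝔸).mul_mem ((unitaryUnits 𝔸).inv_mem hw₂y') hw₂x)
  have hCn : ‖((((w₂ y)⁻¹ * w₂ x : 𝔸ˣ)) : 𝔸) - 1‖ ≤ a := by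
    rw [hw₂y]; exact h167₂ j hj z r'
  -- factor D = e^{(R̄ r)(x)} = R(transporter) e^{r(x)}
  have hDn : ‖exp (ρ x) - 1‖ ≤ 2 * 1116 * b ^ 2 := by
    rw [hρ, R0lie_apply, exp_cj, cj_sub_one,
      norm_cj_of_mem_unitary ((mem_unitaryUnits).1 (hol_mem_of hVj _ _))]
    exact ((norm_exp_phase_sub_one_le (expUnit_phase_mem_unitaryUnits hE hx₁ hx₂ hx₁₂) (hrs x)).1).trans (hB x)
  calc ‖exp (-ρ y) * cj (w₂ y)⁻¹ ((((w₁ y)⁻¹ * w₁ x : 𝔸ˣ)) : 𝔸) * ((((w₂ y)⁻¹ * w₂ x : 𝔸ˣ)) : 𝔸) * exp (ρ x) - 1‖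
      ≤ ‖exp (-ρ y) - 1‖ + ‖cj (w₂ y)⁻¹ ((((w₁ y)⁻¹ * w₁ x : 𝔸ˣ)) : 𝔸) - 1‖ +
          ‖((((w₂ y)⁻¹ * w₂ x : 𝔸ˣ)) : 𝔸) - 1‖ + ‖exp (ρ x) - 1‖ :=
        norm_mul₄_sub_one_le_of_unitary hA hBu hCu
    _ ≤ 2 * 1116 * b ^ 2 + a + a + 2 * 1116 * b ^ 2 := by gcongr
    _ = 2 * a + 4 * 1116 * b ^ 2 := by ring

/-- **(175), second line ⇒ (167) for `u₁u₂` with the printed constant** ("`< (2α₃ + 2C₃α₃²)L^{j+1}η`, `j = 0, 1, …, k − 1`"):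
`2α₃L^{j+1}η + 4C₃(α₃Lʲη)² ≤ (2α₃ + 2C₃α₃²)L^{j+1}η` because `2Lʲη ≤ 1` for `j < k` (print: `η = L^{−k}`, `L ≥ 2`; here from
`L^kη ≤ 1`), so `u₁u₂` satisfies (167) with `2α₃ + 2C₃α₃²`, `C₃ = 1116`. [cite: Balaban1985Averaging, (175) p.45, (167) p.44] -/
theorem cond167_mul_printed :
    Cond167 L U₀ (u₁ * u₂) k (2 * α₃ + 2 * 1116 * α₃ ^ 2) η := by
  have hL1 : 1 ≤ L := le_trans (by norm_num) hL
  have hLr2 : (2 : ℝ) ≤ L := by exact_mod_cast hL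
  rw [cond167_iff_R0fun]
  intro j hj z r'
  refine (ineq175_line2 hV hu₁ hu₂ hL hη hk hα0 hα h₁ h₂ j hj z r').trans ?_
  obtain ⟨hj1', -⟩ := pow_eta_le hL1 hη hk (Nat.succ_le_of_lt hj)
  have hj1 : (L : ℝ) ^ (j + 1) * η ≤ 1 := hj1'
  have ht0 : 0 ≤ (L : ℝ) ^ j * η := by positivity
  have e0 : (L : ℝ) ^ (j + 1) * η = (L : ℝ) * ((L : ℝ) ^ j * η) := by ring
  have hLt : (L : ℝ) * ((L : ℝ) ^ j * η) ≤ 1 := by rw [← e0]; exact hj1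
  -- `2Lʲη ≤ LLʲη ≤ 1`, hence `2(Lʲη)² ≤ Lʲη ≤ L·Lʲη = L^{j+1}η`
  have h2t : 2 * ((L : ℝ) ^ j * η) ≤ 1 := (mul_le_mul_of_nonneg_right hLr2 ht0).trans hLt
  have key : 2 * ((L : ℝ) ^ j * η) ^ 2 ≤ (L : ℝ) ^ (j + 1) * η := by
    rw [e0]
    nlinarith [mul_le_mul_of_nonneg_left h2t ht0, mul_le_mul_of_nonneg_right (show (1 : ℝ) ≤ L by linarith) ht0]
  have e1 : (α₃ * (L : ℝ) ^ j * η) ^ 2 = α₃ ^ 2 * ((L : ℝ) ^ j * η) ^ 2 := by ring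
  have e2 : (2 * α₃ + 2 * 1116 * α₃ ^ 2) * (L : ℝ) ^ (j + 1) * η =
      2 * (α₃ * (L : ℝ) ^ (j + 1) * η) + 2 * 1116 * (α₃ ^ 2 * ((L : ℝ) ^ (j + 1) * η)) := by ring
  rw [e1, e2]
  nlinarith [mul_le_mul_of_nonneg_left key (sq_nonneg α₃)]

/-- **Proposition 8 WITH THE PRINTED CONSTANTS, at a general unitary background, kernel form.**  Print (p. 45): "If
`u₁, u₂ ∈ Λ_k(U₀, α₃)` and `α₃` is sufficiently small, i.e., `α₃ ≦ c₆` for some `c₆`, then `u = u₁u₂ ∈ Λ_k(U₀, 2α₃ + 2C₃α₃²)`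
and we have (173)."  Here: `𝔸` a C⋆-algebra (e.g. `M_N(ℂ)` with the operator norm (19)), `u₁, u₂` UNITARY-valued (print's
`G ⊂ U(N)`), `U₀ : ℤ^d → (Fin d → 𝔸ˣ)` with unitary-valued averaged backgrounds `Ū₀ʲ`, `j < k`; `Λ_k(U₀, ·) = B7Eq167Flat.InLambda L U₀`
(`≤` for `<`, `η` free with `L^kη ≤ 1` — print `η = L^{−k}`), `L ≥ 2`, `0 ≤ α₃ ≤ 1/3000` (an admissible `c₆`), and `C₃ = 1116` =
the tree's constant of (170)/(173): `u₁u₂ ∈ Λ_k(U₀, 2α₃ + 2C₃α₃²)`; (173) is `B7Prop8General.eq173_general`.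
[cite: Balaban1985Averaging, Proposition 8 p.45, (166)–(175) pp.44–45] -/
theorem prop8_printed :
    InLambda L U₀ (u₁ * u₂) k (2 * α₃ + 2 * 1116 * α₃ ^ 2) η :=
  ⟨cond166_mul_printed hV hu₁ hu₂ hL hη hk hα0 hα h₁ h₂, cond167_mul_printed hV hu₁ hu₂ hL hη hk hα0 hα h₁ h₂⟩

/-- Proposition 8 literally — "`u = u₁u₂ ∈ Λ_k(U₀, 2α₃ + 2C₃α₃²)` AND we have (173)": the conjunction of `prop8_printed` with
(171)–(173) (`B7Prop8General.eq173_general`: `\overline{R₀(u₁u₂)}ʲ = \overline{R₀u₁}ʲ·\overline{R₀u₂}ʲ·e^{r_j}`, `‖r_j‖ ≤ 2C₃(α₃Lʲη)²`,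
`j ≤ k`). [cite: Balaban1985Averaging, Proposition 8 p.45, (173) p.45] -/
theorem prop8_printed_with173 :
    InLambda L U₀ (u₁ * u₂) k (2 * α₃ + 2 * 1116 * α₃ ^ 2) η ∧
      ∀ j ≤ k, ∃ r : Site d → 𝔸,
        uavg L U₀ (u₁ * u₂) j = vprod (uavg L U₀ u₁ j) (uavg L U₀ u₂ j) r ∧
          ∀ z, ‖r z‖ ≤ 2 * 1116 * (α₃ * (L : ℝ) ^ j * η) ^ 2 := by
  have ht : α₃ * (L : ℝ) ^ k * η ≤ 1 / 3000 := by
    rw [mul_assoc]; exact (mul_le_of_le_one_right hα0 hk).trans hα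
  exact ⟨prop8_printed hV hu₁ hu₂ hL hη hk hα0 hα h₁ h₂,
    eq173_general (levels_mem_unitary hV) hL hη hα0 (hα.trans (by norm_num)) ht h₁ h₂⟩

end Printed

section Of52

variable {L : ℕ} {U₀ : Site d → Fin d → 𝔸ˣ} {u₁ u₂ : Site d → 𝔸ˣ} {k : ℕ} {α₃ η : ℝ}

/-- **Proposition 8 with the printed constants for a UNITARY background with the regularity (52)**: the unitarity of the
averaged backgrounds `Ū₀ʲ` is then Proposition 2's closure statement (`B7Prop2Explicit.prop2_unitaryUnits`), so the hypotheses
left are print's — `U₀`, `u₁`, `u₂` `G`-valued, (52) `|U₀(∂p) − 1| < α₀η²` with `α₀` within Prop. 2's explicit thresholds,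
`u₁, u₂ ∈ Λ_k(U₀, α₃)`, `α₃ ≤ 1/3000`: `u₁u₂ ∈ Λ_k(U₀, 2α₃ + 2C₃α₃²)`, `C₃ = 1116`.
[cite: Balaban1985Averaging, Proposition 8 p.45, Proposition 2 (52)–(54) p.26] -/
theorem prop8_printed_of52 [Nontrivial 𝔸] (hL : 2 ≤ L) (hη : 0 ≤ η) (hk : (L : ℝ) ^ k * η ≤ 1)
    (hα0 : 0 ≤ α₃) (hα : α₃ ≤ 1 / 3000)
    (hU : ∀ (x : Site d) (κ : Fin d), U₀ x κ ∈ unitaryUnits 𝔸)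
    (hu₁ : ∀ x, u₁ x ∈ unitaryUnits 𝔸) (hu₂ : ∀ x, u₂ x ∈ unitaryUnits 𝔸)
    {α₀ : ℝ} (hα₀ : 0 < α₀) (hα₀3 : C0 d * α₀ ≤ 1 / 3) (hα₀2 : 2 * α₀ ≤ c2' d L)
    (h52 : pdev U₀ < α₀ * (((L : ℝ) ^ k)⁻¹) ^ 2)
    (h₁ : InLambda L U₀ u₁ k α₃ η) (h₂ : InLambda L U₀ u₂ k α₃ η) :
    InLambda L U₀ (u₁ * u₂) k (2 * α₃ + 2 * 1116 * α₃ ^ 2) η := by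
  have hmem := (prop2_unitaryUnits (d := d) L hL k U₀ hU hα₀ hα₀3 hα₀2 h52).2
  exact prop8_printed (fun j hj x κ => hmem j hj.le x κ) hu₁ hu₂ hL hη hk hα0 hα h₁ h₂

end Of52

end Literature.MathematicalPhysics.QuantumFieldTheory.Balaban1983to89.B7Prop8PrintedConstants

end
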